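import Literature.Topology.FourManifolds.TrisectionsSectorTwoDecomposition
import HarnessLib

/-!
# The top face of the second sector: the gap function and its regular zero set

Topic `Literature/Topology/FourManifolds`; step G (part a) of a Morse-theoretic construction of
Gay–Kirby's trisection for the fact seat
`provefact-Literature.Topology.FourManifolds.exists_isBalancedGKTrisection` (Gay–Kirby 2016,
Thm. 4 via §4, Lemma 14).  Everything in this file is **proved**; the one definition (the gap
function) is explicit.

The face `X₂ ∩ X₃ = {s = T, 0 ≤ T}` of the sectors of `TrisectionsSectorsOneThree.lean` (Gay–Kirby's
`H₂₃`, the handlebody `H₁₂` surgered along the attaching circles of the `2`-handles) is studied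
through the **gap function** `γ = (f - a) - T_bot` (`HandleBoxes.gapFn`).  On the band its
derivative along the gradient-like field is `(1 - D) ξ(f) > 0` (`mlineDeriv_gapFn_eq`,
`TrisectionsSectorTwoDecomposition.HandleBoxes.mlineDeriv_topHeightBot_eq` with `D ≤ 0`), so
`0` is a regular value of `γ` as soon as its zeros lie in the band off the critical points
(`isRegularLevel_gapFn`): the zero set `N = {γ = 0}` is a closed `3`-manifold in `X`
(`Literature.RegularLevel`), transverse to the flow, and the top face is its part above the
level, `X₂ ∩ X₃ = N ∩ {0 ≤ s}` (`sectorTwo_inter_sectorThree_eq`); the other two faces are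
`X₁ ∩ X₂ = {s = 0, 0 ≤ T}` and `X₁ ∩ X₃ = {T = 2s, s ≤ 0}` and the central surface is
`{s = 0, T = 0}` (`TrisectionsSectorsOneThree`).

## References

* D. Gay, R. Kirby, *Trisecting 4-manifolds*, Geom. Topol. 20 (2016), §4, Lemma 14. [GayKirby2016]
* J. Milnor, *Lectures on the h-cobordism theorem* (1965), Def. 3.1, Thm. 3.4. [MilnorHCobordism1965]
-/

open scoped Manifold ContDiff Topology
open Set Function Filter

noncomputable section

universe u

namespace Literature.Topology.FourManifolds

open Flow

/-- Local notation: `𝔼 n` is the model Euclidean space `EuclideanSpace ℝ (Fin n)`. -/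
local notation "𝔼 " n:arg => EuclideanSpace ℝ (Fin n)

variable {X : Type u} [TopologicalSpace X] [T2Space X] [CompactSpace X] [ChartedSpace (𝔼 4) X]
  [IsManifold (𝓡 4) ∞ X]

namespace HandleBoxes

variable {f : X → ℝ} {ξ : Π x : X, TangentSpace (𝓡 4) x} {a η : ℝ} {ι : Type} [Fintype ι]
  (H : HandleBoxes f ξ a η ι)
  {hξ : ContMDiff (𝓡 4) (𝓡 4).tangent ∞ fun x => (⟨x, ξ x⟩ : TangentBundle (𝓡 4) X)}
  {h : IsRegularLevel (𝓡 4) f a} {φ : RegularLevel h → ℝ} {h₂ TP χlo χhi : ℝ → ℝ}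
  {Spl Sbot Smin Psw : ℝ}

/-- **The gap function** `γ = (f - a) - T_bot`, whose zero set contains the top face of the
second sector. [cite: GayKirby2016, §4, Lemma 14] -/
def gapFn (hξ : ContMDiff (𝓡 4) (𝓡 4).tangent ∞ fun x => (⟨x, ξ x⟩ : TangentBundle (𝓡 4) X))
    (h : IsRegularLevel (𝓡 4) f a) (φ : RegularLevel h → ℝ) (h₂ TP χlo χhi : ℝ → ℝ)
    (Spl Sbot Smin Psw : ℝ) (z : X) : ℝ :=
  (f z - a) - H.topHeightBot hξ h φ h₂ TP χlo χhi Spl Sbot Smin Psw z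

/-- Value of the gap function. [folklore] -/
theorem gapFn_apply (z : X) : H.gapFn hξ h φ h₂ TP χlo χhi Spl Sbot Smin Psw z =
    (f z - a) - H.topHeightBot hξ h φ h₂ TP χlo χhi Spl Sbot Smin Psw z := rfl

/-- The gap function is smooth. [folklore] -/
theorem contMDiff_gapFn (hfM : IsMorse (𝓡 4) f) (hχlo : ContDiff ℝ ∞ χlo)
    (hT : ContMDiff (𝓡 4) 𝓘(ℝ, ℝ) ∞ (H.topHeight hξ h φ h₂ TP χlo χhi Spl Smin Psw)) :
    ContMDiff (𝓡 4) 𝓘(ℝ, ℝ) ∞ (H.gapFn hξ h φ h₂ TP χlo χhi Spl Sbot Smin Psw) :=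
  (hfM.contMDiff.sub contMDiff_const).sub (H.contMDiff_topHeightBot hfM hχlo hT)

/-- **`ξ(γ) = (1 - D) ξ(f)` on the band.** [cite: GayKirby2016, §4, Lemma 14] -/
theorem mlineDeriv_gapFn_eq (hgl : IsGradientLike (𝓡 4) f ξ) (hfM : IsMorse (𝓡 4) f)
    (hT : ContMDiff (𝓡 4) 𝓘(ℝ, ℝ) ∞ (H.topHeight hξ h φ h₂ TP χlo χhi Spl Smin Psw))
    (hχlo : ContDiff ℝ ∞ χlo) (hχhi : ContDiff ℝ ∞ χhi)
    {P₁ v₁ : ℝ} (hPsw0 : 0 < Psw) (hPsw : 2 * Psw ≤ η ^ 2) (hP₁ : 2 * P₁ < Psw)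
    (hTP₂ : ∀ P, 2 * P₁ ≤ P → TP P = Spl) (hh₂v : ∀ t ≤ v₁, h₂ t = Spl)
    (hφv : ∀ j (y : RegularLevel h), y.1 ∈ (H.box j).chart.source → H.P j y.1 < 2 * Psw → φ y ≤ v₁)
    {z : X} (hf₁ : a - η < f z) (hf₂ : f z < a + 2 * η) :
    mlineDeriv (𝓡 4) (H.gapFn hξ h φ h₂ TP χlo χhi Spl Sbot Smin Psw) z (ξ z) =
      (1 - H.topCoeffBot hξ h φ h₂ TP χlo χhi Spl Sbot Smin Psw z) * mlineDeriv (𝓡 4) f z (ξ z) := by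
  have hfd : MDifferentiableAt (𝓡 4) 𝓘(ℝ, ℝ) f z := hfM.contMDiff.mdifferentiableAt (by simp)
  have hsd : MDifferentiableAt (𝓡 4) 𝓘(ℝ, ℝ) (fun y => f y - a) z := hfd.sub mdifferentiableAt_const
  have hTd : MDifferentiableAt (𝓡 4) 𝓘(ℝ, ℝ) (H.topHeightBot hξ h φ h₂ TP χlo χhi Spl Sbot Smin Psw) z :=
    (H.contMDiff_topHeightBot hfM hχlo hT z).mdifferentiableAt (by simp)
  have hs : mlineDeriv (𝓡 4) (fun y => f y - a) z (ξ z) = mlineDeriv (𝓡 4) f z (ξ z) := by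
    have hd : HasDerivAt (fun q : ℝ => q - a) 1 (f z) := by simpa using (hasDerivAt_id (f z)).sub_const a
    have := mlineDeriv_real_comp' hd hfd (ξ z)
    simpa using this
  rw [mlineDeriv_def, show H.gapFn hξ h φ h₂ TP χlo χhi Spl Sbot Smin Psw =
      (fun y => f y - a) - H.topHeightBot hξ h φ h₂ TP χlo χhi Spl Sbot Smin Psw from rfl,
    (hsd.hasMFDerivAt.sub hTd.hasMFDerivAt).mfderiv]
  show mlineDeriv (𝓡 4) (fun y => f y - a) z (ξ z) -
      mlineDeriv (𝓡 4) (H.topHeightBot hξ h φ h₂ TP χlo χhi Spl Sbot Smin Psw) z (ξ z) = _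
  rw [hs, H.mlineDeriv_topHeightBot_eq hgl hfM hT hχlo hχhi hPsw0 hPsw hP₁ hTP₂ hh₂v hφv hf₁ hf₂]
  ring

/-- The top height lies between `-S_min` and `S_bot` when `-S_min ≤ T_raw ≤ S_bot` and the
cut-offs take values in `[0, 1]`. [folklore] -/
theorem topHeightBot_mem_Icc (hχlo01 : ∀ s, χlo s ∈ Icc (0 : ℝ) 1) (hχhi01 : ∀ s, χhi s ∈ Icc (0 : ℝ) 1)
    (hSbot : 0 ≤ Sbot) (hSmin : 0 ≤ Smin)
    (hraw : ∀ z, H.topRaw hξ h φ h₂ TP Spl Psw z ∈ Icc (-Smin) Sbot) (z : X) :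
    H.topHeightBot hξ h φ h₂ TP χlo χhi Spl Sbot Smin Psw z ∈ Icc (-Smin) Sbot := by
  rw [topHeightBot_eq]
  obtain ⟨hl0, hl1⟩ := hχlo01 (f z - a)
  obtain ⟨hh0, hh1⟩ := hχhi01 (f z - a)
  obtain ⟨hr0, hr1⟩ := hraw z
  set L := χlo (f z - a)
  set K := χhi (f z - a)
  set R := H.topRaw hξ h φ h₂ TP Spl Psw z
  constructor
  · -- lower bound
    have h1 : L * K * R ≥ L * K * (-Smin) := by
      have : 0 ≤ L * K := mul_nonneg hl0 hh0
      nlinarith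
    have h2 : (1 - L) * Sbot ≥ 0 := mul_nonneg (by linarith) hSbot
    have h3 : (1 - K) * Smin ≤ (1 - L * K) * Smin := by
      have : L * K ≤ K := by nlinarith
      nlinarith
    nlinarith
  · have h1 : L * K * R ≤ L * K * Sbot := by
      have : 0 ≤ L * K := mul_nonneg hl0 hh0
      nlinarith
    have h2 : (1 - K) * Smin ≥ 0 := mul_nonneg (by linarith) hSmin
    have h3 : L * K * Sbot + (1 - L) * Sbot ≤ Sbot := by
      have : L * K ≤ L := by nlinarith
      nlinarith
    nlinarith

/-- **`0` is a regular value of the gap function**: its zeros lie in the band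
(`-S_min ≤ T ≤ S_bot` with `S_min < η`, `S_bot < 2η`), where `ξ(γ) = (1 - D)ξ(f) > 0` off the
critical points, and the critical points of the band are not zeros (`T(c_j) ≠ η`).
[cite: GayKirby2016, §4, Lemma 14] -/
theorem isRegularLevel_gapFn (hgl : IsGradientLike (𝓡 4) f ξ) (hfM : IsMorse (𝓡 4) f)
    (hT : ContMDiff (𝓡 4) 𝓘(ℝ, ℝ) ∞ (H.topHeight hξ h φ h₂ TP χlo χhi Spl Smin Psw))
    (hχlo : ContDiff ℝ ∞ χlo) (hχhi : ContDiff ℝ ∞ χhi)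
    {P₁ v₁ : ℝ} (hPsw0 : 0 < Psw) (hPsw : 2 * Psw ≤ η ^ 2) (hP₁ : 2 * P₁ < Psw)
    (hTP₂ : ∀ P, 2 * P₁ ≤ P → TP P = Spl) (hh₂v : ∀ t ≤ v₁, h₂ t = Spl)
    (hφv : ∀ j (y : RegularLevel h), y.1 ∈ (H.box j).chart.source → H.P j y.1 < 2 * Psw → φ y ≤ v₁)
    (hTmem : ∀ z, H.topHeightBot hξ h φ h₂ TP χlo χhi Spl Sbot Smin Psw z ∈ Icc (-Smin) Sbot)
    (hSmin : Smin < η) (hSbot : Sbot < 2 * η)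
    (hD : ∀ z, a - η < f z → f z < a + 2 * η → H.topCoeffBot hξ h φ h₂ TP χlo χhi Spl Sbot Smin Psw z ≤ 0)
    (hcpt : ∀ j, H.topHeightBot hξ h φ h₂ TP χlo χhi Spl Sbot Smin Psw (H.cpt j) ≠ η) :
    IsRegularLevel (𝓡 4) (H.gapFn hξ h φ h₂ TP χlo χhi Spl Sbot Smin Psw) 0 where
  contMDiff := H.contMDiff_gapFn hfM hχlo hT
  isInteriorPoint _ _ := isInteriorPoint_euclidean _
  not_isMCriticalPt z hz := by
    have hz' : f z - a = H.topHeightBot hξ h φ h₂ TP χlo χhi Spl Sbot Smin Psw z := by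
      rw [gapFn_apply] at hz; linarith
    obtain ⟨hl, hu⟩ := hTmem z
    have hf₁ : a - η < f z := by linarith
    have hf₂ : f z < a + 2 * η := by linarith
    have hreg : ¬ IsMCriticalPt (𝓡 4) f z := by
      intro hc
      obtain ⟨j, rfl⟩ := H.crit_val z hc hf₁.le hf₂
      apply hcpt j
      have := H.apply_cpt j
      linarith
    intro hc
    have h0 : mlineDeriv (𝓡 4) (H.gapFn hξ h φ h₂ TP χlo χhi Spl Sbot Smin Psw) z (ξ z) = 0 := by
      rw [mlineDeriv_def]
      have hc' : mfderiv (𝓡 4) 𝓘(ℝ, ℝ) (H.gapFn hξ h φ h₂ TP χlo χhi Spl Sbot Smin Psw) z = 0 := hc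
      rw [hc']; rfl
    rw [H.mlineDeriv_gapFn_eq hgl hfM hT hχlo hχhi hPsw0 hPsw hP₁ hTP₂ hh₂v hφv hf₁ hf₂] at h0
    have hξf := hgl.mlineDeriv_pos z hreg
    have hDz := hD z hf₁ hf₂
    have : 0 < (1 - H.topCoeffBot hξ h φ h₂ TP χlo χhi Spl Sbot Smin Psw z) * mlineDeriv (𝓡 4) f z (ξ z) :=
      mul_pos (by linarith) hξf
    linarith

/-- **The top face is the part of the zero set of the gap function above the level**:
`X₂ ∩ X₃ = {γ = 0} ∩ {0 ≤ s}`. [cite: GayKirby2016, §4, Lemma 14] -/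
theorem sectorTwo_inter_sectorThree_eq :
    sectorTwo f a (H.topHeightBot hξ h φ h₂ TP χlo χhi Spl Sbot Smin Psw) ∩
        sectorThree f a (H.topHeightBot hξ h φ h₂ TP χlo χhi Spl Sbot Smin Psw) =
      {z | H.gapFn hξ h φ h₂ TP χlo χhi Spl Sbot Smin Psw z = 0 ∧ 0 ≤ f z - a} := by
  rw [sectorTwo_inter_sectorThree]
  ext z
  simp only [mem_setOf_eq, gapFn_apply]
  constructor
  · rintro ⟨h1, h2⟩; exact ⟨by linarith, by linarith⟩
  · rintro ⟨h1, h2⟩; exact ⟨by linarith, by linarith⟩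

/-- The zero set of the gap function above the level, as the image of the part `{0 ≤ s}` of the
regular level `N = {γ = 0}`. [folklore] -/
theorem image_incl_setOf_nonneg (hg : IsRegularLevel (𝓡 4) (H.gapFn hξ h φ h₂ TP χlo χhi Spl Sbot Smin Psw) 0) :
    RegularLevel.incl hg '' {y : RegularLevel hg | 0 ≤ f y.1 - a} =
      {z | H.gapFn hξ h φ h₂ TP χlo χhi Spl Sbot Smin Psw z = 0 ∧ 0 ≤ f z - a} := by
  ext z
  simp only [mem_image, mem_setOf_eq]
  constructor
  · rintro ⟨y, hy, rfl⟩
    exact ⟨y.2, hy⟩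
  · rintro ⟨hz, hs⟩
    exact ⟨⟨z, hz⟩, hs, rfl⟩

end HandleBoxes

end Literature.Topology.FourManifolds

end
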